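import Literature.Geometry.Symplectic.TaubesCanonicalSolution
import Literature.Geometry.GaugeTheory.SelfDualCurvaturePerturbation
import HarnessLib

/-!
# Taubes's Step 1 for `SW(K⁻¹) = ±1`: the canonical solution `(A₀, √r u₀)` of the `r`-family of
# Seiberg–Witten equations of a symplectic `4`-manifold — unconditional

Topic `Literature/Geometry/Symplectic`; assembles `TaubesCanonicalSolution` (the canonical spinor
`u₀`, Taubes's connection `A₀ = taubesConnection`, the canonical configuration `(A₀, c·u₀)`, and —
since `ds = 0` — `∂_{A₀} u₀ = 0`, Taubes 1994 Lemma 1) with `GaugeTheory/SelfDualCurvaturePerturbation`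
(`F_A⁺` as a perturbation, `(A, 0)` solves `(SW_{F_A⁺})`).

C. H. Taubes, *The Seiberg–Witten and Gromov invariants*, Math. Res. Lett. 2 (1995), §5, Step 1
(p. 233): "consider the case where `E` in (4.3) is the trivial bundle … (5.1) `S₊ = I ⊕ K⁻¹` … the bundle
`K⁻¹` has a unique connection (up to gauge equivalence), `A₀`, … the section `u₀` of `I` … is annihilated
by the Dirac operator `D_{A₀}` … for `r ≥ 0` the following family of perturbations of (4.5):
(5.2) `D_A ψ = 0` and `P₊F_A = ¼τ(ψ ⊗ ψ*) + P₊F_{A₀} - (i/4)·r·ω`. … Note that `(A₀, √r·u₀)` solves (5.2)";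
C. H. Taubes, Math. Res. Lett. 1 (1994), §1 (5): "the pair `(A₀, u₀)` is, by construction, a solution".

* `taubesPerturbation h hs hnd = P₊F_{A₀}` (the `selfDualCurvaturePerturbation` of `A₀`);
* **`isSolution_canonicalConfiguration_taubes`**: for every `c ∈ ℂ`, `(A₀, c·u₀)` solves the
  Seiberg–Witten equations with perturbation `P₊F_{A₀} - (|c|²/4)·s` — for `c = √r` this is (5.2);
* `isIrreducible_canonicalConfiguration_taubes`: it is irreducible for `c ≠ 0` (`r > 0`).

PROVED, 0 named facts (Step 1 of Taubes's proof of `SW(K⁻¹) = ±1`; Steps 2–6 — that for `r ≫ 0`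
this is the only solution up to gauge and is non-degenerate — are the analytic heart, not here).

## References

* C. H. Taubes, *The Seiberg–Witten and Gromov invariants*, Math. Res. Lett. 2 (1995) 221–238,
  §5 Step 1, (5.1)–(5.2). [Taubes1995]
* C. H. Taubes, *The Seiberg–Witten invariants and symplectic forms*, Math. Res. Lett. 1 (1994)
  809–822, §1 (5), Lemma 1. [Taubes1994]
-/

noncomputable section

open scoped Manifold ContDiff
open Complex Literature.Geometry.Kaehler Literature.Geometry.GaugeTheory Literature.Topology.FourManifolds
open Literature.Geometry.Lorentzian (PseudoRiemannianMetric)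

namespace Literature.Geometry.Symplectic

namespace AlmostComplexStructure.IsCompatibleWith

variable {N : Type*} [TopologicalSpace N] [ChartedSpace (EuclideanSpace ℝ (Fin 4)) N]
  [IsManifold (𝓡 4) ∞ N] {J : AlmostComplexStructure (𝓡 4) ∞ N} {s : MForm (𝓡 4) N ℝ 2}
  (h : J.IsCompatibleWith s) (hs : IsSmoothForm s)
  (hnd : ∀ x (v : TangentSpace (𝓡 4) x), v ≠ 0 → ∃ w : TangentSpace (𝓡 4) x, s x ![v, w] ≠ 0)
  [(h.metric hs).HasLeviCivita]

/-- **Taubes's perturbation `P₊F_{A₀}`**: the self-dual part of the curvature of Taubes's connection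
`A₀` on `K⁻¹`, as a perturbation of the Seiberg–Witten equations of the canonical `Spin^c` structure.
[cite: Taubes1995, §5 Step 1 (5.2) (p. 233)] -/
def taubesPerturbation : (h.canonicalSpincStructure hs hnd).Perturbation :=
  (h.canonicalSpincStructure hs hnd).selfDualCurvaturePerturbation (h.taubesConnection hs hnd)

/-- The form of Taubes's perturbation is `F_{A₀}⁺` (definitional). [folklore] -/
@[simp] theorem taubesPerturbation_form :
    (h.taubesPerturbation hs hnd).form = (h.canonicalSpincStructure hs hnd).sdCurvatureForm (h.taubesConnection hs hnd) :=
  rfl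

/-- **Taubes 1995, §5 Step 1: `(A₀, √r u₀)` solves (5.2).**  On a closed symplectic `4`-manifold
`(N, s)` with compatible `J` (here: `J` compatible with the smooth, closed, non-degenerate `s`), for
every `c ∈ ℂ` the configuration `(A₀, c·u₀)` — Taubes's connection on `K⁻¹` and `c` times the unit
section of `I ⊂ S₊ = I ⊕ K⁻¹` — solves the Seiberg–Witten equations of the canonical `Spin^c` structure
with perturbation `P₊F_{A₀} - (|c|²/4)·s`:  `D_A ψ = 0` (Taubes 1994, Lemma 1: `ds = 0`) and
`P₊F_A = ¼τ(ψ ⊗ ψ*) + P₊F_{A₀} - (|c|²/4)·s` (`q(c u₀) = (|c|²/4)·iρ⁺(s)`).  For `c = √r` this is the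
family (5.2), `P₊F_A = ¼τ(ψ ⊗ ψ*) + P₊F_{A₀} - (i/4) r ω`. [cite: Taubes1995, §5 Step 1 (5.2) (p. 233)] -/
theorem isSolution_canonicalConfiguration_taubes (hcl : IsClosedForm s) (c : ℂ) :
    SpincStructure.IsSolution
      (h.taubesPerturbation hs hnd - h.symplecticPerturbation hs hnd (Complex.normSq c / 4))
      (h.canonicalConfiguration hs hnd (h.taubesConnection hs hnd) c) :=
  h.isSolution_canonicalConfiguration_taubesConnection_of_isClosedForm hs hnd hcl _
    ((h.canonicalSpincStructure hs hnd).isSolution_ofConnection_selfDualCurvaturePerturbation _) c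

/-- **… and `(A₀, c·u₀)` is irreducible for `c ≠ 0`** (`ψ = √r u₀ ≠ 0` for `r > 0`).
[cite: Taubes1995, §5 Step 1 (p. 233)] -/
theorem isIrreducible_canonicalConfiguration_taubes [Nonempty N] {c : ℂ} (hc : c ≠ 0) :
    (h.canonicalConfiguration hs hnd (h.taubesConnection hs hnd) c).IsIrreducible :=
  h.isIrreducible_canonicalConfiguration hs hnd _ hc

end AlmostComplexStructure.IsCompatibleWith

end Literature.Geometry.Symplectic

end
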